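import Summits.QuantumFields.YangMills.Theorems.BalabanLadderNTCouplingSumRule
import HarnessLib

/-!
# Crux `NT` (stmt-QuantumFields-19353): the zero-momentum sum rule, II — the volume-uniform β-BUDGET of the zero-momentum
# two-point function at weak coupling (hypothesis-free)

Sequel of `Theorems/BalabanLadderNTCouplingSumRule` (fleet lead prover of crux `NT`, unit `ym-spine-19353-p1`, g8); general compact
`G`, any lattice representation `r`.  With `χ_L(β; x) := Σ_{z ∈ box L} Cov_{T,β}(A_x, A_z) = ∂_β E_{T,β}[A_x] ≥ 0` (part I) and the
tree's volume-uniform chessboard moments `⟨φ_q⟩_{T,β} ≤ K(1 + log β)/β` (`AfOnset.exists_plaquetteCost_moments_le`, odd tori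
`2L+1 ≥ 3`, `β ≥ 1`):

* `torusE_dens_eq_sum_orient` (`E_{T,β}[A_x] = Σ_q (N − ⟨φ_{(x̄,q)}⟩)`), `torusE_dens_le` (`E_{T,β}[A_x] ≤ 6N`),
  `exists_six_mul_sub_torusE_dens_le` (`6N − E_{T,β}[A_x] ≤ 6K(1 + log β)/β`, all `L ≥ 1`, `β ≥ 1`);
* **`exists_integral_sum_torusCov_dens_le`** — `∫_{β₁}^{β₂} χ_L(γ; x) dγ ≤ 6K(1 + log β₁)/β₁` for `1 ≤ β₁ ≤ β₂`, every `L ≥ 1`: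
  the susceptibility is `L¹` in the coupling, uniformly in the volume;
* **`exists_sum_torusCov_dens_le_window`** — for every `L ≥ 1`, `β ≥ 1`, `x` there is `γ ∈ [β, 2β]` with
  `χ_L(γ; x) ≤ 6K(1 + log β)/β²`: the perturbative `β⁻²` law AT ZERO LATTICE MOMENTUM (up to `1 + log β`) on a set of couplings
  meeting every window `[β, 2β]`, uniformly in `L`, without any expansion.

Reading for clause (i) of `LowerBounds` (`Q2_{β,L,a(β)}(θv, v) = Σ_{x,y} θv(a x) v(a y) Cov_T(A_x, A_y)`): its `k = 0` mode is
β-integrable and generically `O(log β/β²)`; a β-UNIFORM floor therefore has to come from lattice momenta `|k| ≍ a(β) → 0`, `k ≠ 0`,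
about which nothing is claimed here.  No decay in `|x − y|`, no floor, nothing of NT, the seam or the gap.  Not Clay.
-/


set_option autoImplicit false

noncomputable section

open MeasureTheory Filter Topology Finset
open scoped BigOperators
open Literature.MathematicalPhysics.QuantumFieldTheory hiding ZdEdge
open Literature.MathematicalPhysics.QuantumLattice
open Literature.Probability.LatticeModels (Site box mem_box card_box)
open Summit.QuantumFields.YangMills.Cruxes.OSLegsFromFemtoAndGap.DlrCollarTransfer
open Summit.QuantumFields.YangMills.Cruxes.OSLegsFromFemtoAndGap.DlrCollarTransfer.StubLower (exists_abs_dens_le)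
open Summit.QuantumFields.YangMills.Cruxes.UVSeamRec.ResponsePinning (integrable_comp_lift)
open Summit.QuantumFields.YangMills.Theorems.CurvatureBoostCovariance.Negative (card_planes)
open Summit.QuantumFields.YangMills.Theorems.OSLegsFromFemtoAndGap (torusE_dens_eq_wilsonTorusMean)
open Summit.QuantumFields.YangMills.Cruxes.IR.AfOnset (dens_torusLift_eq exists_plaquetteCost_moments_le
  integral_const_sub_mul_const_sub)
open Summit.QuantumFields.YangMills.Cruxes.NT.SkewResponse (hasDerivAt_torusE_coupling)
open Literature.MathematicalPhysics.QuantumFieldTheory.WilsonRP (plaqRe abs_plaqRe_le measurable_plaqRe)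

namespace Summit.QuantumFields.YangMills.Cruxes.NT.CouplingSumRule

section Main

variable (G : Type) [Group G] [TopologicalSpace G] [IsTopologicalGroup G] [CompactSpace G]
  [MeasurableSpace G] [BorelSpace G] (r : LatticeRep G)

/-! ## §3 Weak coupling, uniformly in the volume: the β-budget of the zero-momentum two-point function -/

/-- **The one-point function through the plaquette costs**: `E_{T,β}[A_x] = Σ_q (N − ⟨φ_{(x̄,q)}⟩_{T,β})` over the six
orientations (`AfOnset.dens_torusLift_eq`). [folklore] -/
theorem torusE_dens_eq_sum_orient (β : ℝ) (L : ℕ) (x : Fin 4 → ℤ) :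
    torusE G r β L (dens G r x) = ∑ q : {q : Fin 4 × Fin 4 // q.1 < q.2},
      ((r.N : ℝ) - ∫ U, plaquetteCost r.ρ U (Literature.Probability.LatticeModels.Torus.proj (2 * L + 1) x, q)
        ∂(wilsonMeasure (d := 4) (L := 2 * L + 1) r.ρ β)) := by
  haveI := r.secondCountableTopology
  haveI := isProbabilityMeasure_wilsonMeasure (d := 4) (L := 2 * L + 1) r.ρ r.continuous β
  have hqm : ∀ q : Plaquette 4 (2 * L + 1),
      Measurable (fun U : GaugeConfig 4 (2 * L + 1) G => plaquetteCost r.ρ U q) := fun q =>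
    measurable_const.sub (measurable_plaqRe r.ρ r.continuous q)
  have hqb : ∀ (q : Plaquette 4 (2 * L + 1)) (U : GaugeConfig 4 (2 * L + 1) G), |plaquetteCost r.ρ U q| ≤ 2 * r.N := by
    intro q U
    have h := abs_le.1 (abs_plaqRe_le r.ρ r.continuous U q)
    change |(r.N : ℝ) - plaqRe r.ρ U q| ≤ 2 * r.N
    rw [abs_le]; constructor <;> linarith [h.1, h.2]
  have hqi : ∀ q : Plaquette 4 (2 * L + 1),
      Integrable (fun U : GaugeConfig 4 (2 * L + 1) G => plaquetteCost r.ρ U q)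
        (wilsonMeasure (d := 4) (L := 2 * L + 1) r.ρ β) := fun q => integrable_of_abs_le (hqm q) (hqb q)
  have hqi' : ∀ q : Plaquette 4 (2 * L + 1),
      Integrable (fun U : GaugeConfig 4 (2 * L + 1) G => (r.N : ℝ) - plaquetteCost r.ρ U q)
        (wilsonMeasure (d := 4) (L := 2 * L + 1) r.ρ β) := fun q => (integrable_const _).sub (hqi q)
  unfold torusE
  simp_rw [dens_torusLift_eq]
  rw [integral_finsetSum Finset.univ
    (f := fun (q : {q : Fin 4 × Fin 4 // q.1 < q.2}) (U : GaugeConfig 4 (2 * L + 1) G) =>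
      (r.N : ℝ) - plaquetteCost r.ρ U (Literature.Probability.LatticeModels.Torus.proj (2 * L + 1) x, q))
    (fun q _ => hqi' _)]
  refine Finset.sum_congr rfl fun q _ => ?_
  rw [integral_sub (integrable_const _) (hqi _), integral_const, probReal_univ, one_smul]

/-- **`E_{T,β}[A_x] ≤ 6N`** (plaquette costs are non-negative). [folklore] -/
theorem torusE_dens_le (β : ℝ) (L : ℕ) (x : Fin 4 → ℤ) : torusE G r β L (dens G r x) ≤ 6 * (r.N : ℝ) := by
  haveI := r.secondCountableTopology
  haveI := isProbabilityMeasure_wilsonMeasure (d := 4) (L := 2 * L + 1) r.ρ r.continuous β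
  rw [torusE_dens_eq_sum_orient]
  have h0 : ∀ q : Plaquette 4 (2 * L + 1), 0 ≤ ∫ U, plaquetteCost r.ρ U q ∂(wilsonMeasure (d := 4) (L := 2 * L + 1) r.ρ β) :=
    fun q => integral_nonneg fun U => by
      have h := abs_le.1 (abs_plaqRe_le r.ρ r.continuous U q)
      change 0 ≤ (r.N : ℝ) - plaqRe r.ρ U q
      linarith [h.2]
  calc ∑ q : {q : Fin 4 × Fin 4 // q.1 < q.2},
        ((r.N : ℝ) - ∫ U, plaquetteCost r.ρ U (Literature.Probability.LatticeModels.Torus.proj (2 * L + 1) x, q)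
          ∂(wilsonMeasure (d := 4) (L := 2 * L + 1) r.ρ β))
      ≤ ∑ _q : {q : Fin 4 × Fin 4 // q.1 < q.2}, (r.N : ℝ) :=
        Finset.sum_le_sum fun q _ => sub_le_self _ (h0 _)
    _ = 6 * (r.N : ℝ) := by rw [Finset.sum_const, Finset.card_univ, card_planes, nsmul_eq_mul]; push_cast; ring

/-- **Freezing of the one-point function, uniformly in the volume**: there is `K ≥ 0` (the tree's chessboard constant of
`AfOnset.exists_plaquetteCost_moments_le`) with `6N − E_{T,β}[A_x] ≤ 6K(1 + log β)/β` for all `L ≥ 1`, `β ≥ 1`, `x`. [folklore] -/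
theorem exists_six_mul_sub_torusE_dens_le :
    ∃ K : ℝ, 0 ≤ K ∧ ∀ (L : ℕ), 1 ≤ L → ∀ β : ℝ, 1 ≤ β → ∀ x : Fin 4 → ℤ,
      6 * (r.N : ℝ) - torusE G r β L (dens G r x) ≤ 6 * K * (1 + Real.log β) / β := by
  obtain ⟨K, hK0, hK⟩ := exists_plaquetteCost_moments_le r
  refine ⟨K, hK0, fun L hL β hβ x => ?_⟩
  rw [torusE_dens_eq_sum_orient]
  have h1 : ∀ q : Plaquette 4 (2 * L + 1),
      ∫ U, plaquetteCost r.ρ U q ∂(wilsonMeasure (d := 4) (L := 2 * L + 1) r.ρ β) ≤ K * (1 + Real.log β) / β :=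
    fun q => (hK L hL β hβ q).1
  have hsum : ∑ q : {q : Fin 4 × Fin 4 // q.1 < q.2},
      ∫ U, plaquetteCost r.ρ U (Literature.Probability.LatticeModels.Torus.proj (2 * L + 1) x, q)
        ∂(wilsonMeasure (d := 4) (L := 2 * L + 1) r.ρ β) ≤ 6 * (K * (1 + Real.log β) / β) := by
    calc _ ≤ ∑ _q : {q : Fin 4 × Fin 4 // q.1 < q.2}, K * (1 + Real.log β) / β := Finset.sum_le_sum fun q _ => h1 _
      _ = 6 * (K * (1 + Real.log β) / β) := by
        rw [Finset.sum_const, Finset.card_univ, card_planes, nsmul_eq_mul]; push_cast; ring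
  rw [Finset.sum_sub_distrib, Finset.sum_const, Finset.card_univ, card_planes, nsmul_eq_mul]
  push_cast
  have : 6 * K * (1 + Real.log β) / β = 6 * (K * (1 + Real.log β) / β) := by ring
  rw [this]
  linarith

/-- **β-budget of the zero-momentum two-point function, uniformly in the volume**: with the same `K`, for all `L ≥ 1`,
`1 ≤ β₁ ≤ β₂` and `x`: `∫_{β₁}^{β₂} Σ_z Cov_{T,γ}(A_x, A_z) dγ ≤ 6K(1 + log β₁)/β₁` — the susceptibility is `L¹` in the coupling on
`[1, ∞)`, uniformly in `L`, with tail budget `O(log β₁/β₁)`. [folklore] -/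
theorem exists_integral_sum_torusCov_dens_le :
    ∃ K : ℝ, 0 ≤ K ∧ ∀ (L : ℕ), 1 ≤ L → ∀ β₁ β₂ : ℝ, 1 ≤ β₁ → β₁ ≤ β₂ → ∀ x : Fin 4 → ℤ,
      ∫ γ in β₁..β₂, ∑ z ∈ box 4 L, (torusE G r γ L (fun U => dens G r x U * dens G r z U) -
          torusE G r γ L (dens G r x) * torusE G r γ L (dens G r z)) ≤ 6 * K * (1 + Real.log β₁) / β₁ := by
  obtain ⟨K, hK0, hK⟩ := exists_six_mul_sub_torusE_dens_le G r
  refine ⟨K, hK0, fun L hL β₁ β₂ hβ₁ _ x => ?_⟩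
  rw [integral_sum_torusCov_dens_eq]
  have h2 := torusE_dens_le G r β₂ L x
  have h1 := hK L hL β₁ hβ₁ x
  linarith

/-- **The `β⁻²` law at zero momentum on every coupling window, uniformly in the volume**: with the same `K`, for every
`L ≥ 1`, `β ≥ 1` and `x` there is `γ ∈ [β, 2β]` with `Σ_z Cov_{T,γ}(A_x, A_z) ≤ 6K(1 + log β)/β²` (the minimum of the continuous
susceptibility over `[β, 2β]` times the window length is at most its integral). [folklore] -/
theorem exists_sum_torusCov_dens_le_window :
    ∃ K : ℝ, 0 ≤ K ∧ ∀ (L : ℕ), 1 ≤ L → ∀ β : ℝ, 1 ≤ β → ∀ x : Fin 4 → ℤ, ∃ γ ∈ Set.Icc β (2 * β),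
      ∑ z ∈ box 4 L, (torusE G r γ L (fun U => dens G r x U * dens G r z U) -
          torusE G r γ L (dens G r x) * torusE G r γ L (dens G r z)) ≤ 6 * K * (1 + Real.log β) / β ^ 2 := by
  obtain ⟨K, hK0, hK⟩ := exists_integral_sum_torusCov_dens_le G r
  refine ⟨K, hK0, fun L hL β hβ x => ?_⟩
  set χ : ℝ → ℝ := fun γ => ∑ z ∈ box 4 L, (torusE G r γ L (fun U => dens G r x U * dens G r z U) -
      torusE G r γ L (dens G r x) * torusE G r γ L (dens G r z)) with hχ
  have hβ0 : 0 < β := lt_of_lt_of_le one_pos hβ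
  have hle : β ≤ 2 * β := by linarith
  have hcont : Continuous χ := continuous_sum_torusCov_dens G r L x
  obtain ⟨γ₀, hγ₀, hmin⟩ := isCompact_Icc.exists_isMinOn (Set.nonempty_Icc.2 hle) hcont.continuousOn
  refine ⟨γ₀, hγ₀, ?_⟩
  have hint := hK L hL β (2 * β) hβ hle x
  have hmono : ∫ _γ in β..(2 * β), χ γ₀ ≤ ∫ γ in β..(2 * β), χ γ :=
    intervalIntegral.integral_mono_on hle intervalIntegrable_const (hcont.intervalIntegrable _ _)
      fun γ hγ => hmin hγ
  rw [intervalIntegral.integral_const, smul_eq_mul] at hmono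
  have hlen : 2 * β - β = β := by ring
  rw [hlen] at hmono
  have hchi : χ γ₀ ≤ 6 * K * (1 + Real.log β) / β / β := by
    rw [le_div_iff₀ hβ0]
    calc χ γ₀ * β = β * χ γ₀ := mul_comm _ _
      _ ≤ _ := hmono.trans hint
  calc χ γ₀ ≤ 6 * K * (1 + Real.log β) / β / β := hchi
    _ = 6 * K * (1 + Real.log β) / β ^ 2 := by rw [div_div, sq]

end Main

end Summit.QuantumFields.YangMills.Cruxes.NT.CouplingSumRule

end
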